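import Mathlib
import HarnessLib
import Literature.Analysis.Quadrature.PeriodicTrapezoidalExactness
import Literature.Analysis.Quadrature.EulerMaclaurinTrapezoidal

/-!
# MIPS: Möbius inversion of the Poisson summation formula (Davis–Rabinowitz 1984, Sect. 2.10.6)

Davis–Rabinowitz, *Methods of Numerical Integration* (2nd ed., 1984), Sect. 2.10.6 "MIPS Methods" (held OCR PDF
pp. 133–134): a method for Fourier coefficients proposed by Goldberg and Varga and elaborated by Lyness. With the
Möbius numbers `μ_s` **(2.10.6.1)** (the first ten: `1, -1, -1, 0, -1, 1, -1, 0, 0, 1`), `I(f) = ∫_0^1 f`, the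
endpoint trapezoidal rule `T_s(f) = (1/s)[½ f(0) + Σ_{j=1}^{s-1} f(j/s) + ½ f(1)]`, `ζ(k) = Σ_{j≥1} j^{-k}`,
arbitrary numbers `K_2, …, K_{2n}` and `E_s(f) = T_s(f) - I(f) - ζ(2)K_2/s² - ⋯ - ζ(2n)K_{2n}/s^{2n}` **(2.10.6.2)**,
one has for `f ∈ C[0, 1]` the identity
`2 ∫_0^1 f(x) cos 2πmx dx = K_2/m² + ⋯ + K_{2n}/m^{2n} + Σ_{s≥1} μ_s E_{ms}(f)` **(2.10.6.3)**, and with the choice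
`K_{2q} = 2(-1)^{q-1} (f^{(2q-1)}(1) - f^{(2q-1)}(0))/(2π)^{2q}` **(2.10.6.4)** the `s`-th term is `O(s^{-2n-2})`.

READING NOTE. The OCR of (2.10.6.3) prints the series as `Σ_s μ_s E_s(f)`, which cannot depend on `m`; the
identity is Lyness's `Σ_s μ_s E_{ms}(f)` (Möbius inversion of the Poisson summation formula
`T_s f - I f = 2 Σ_{k≥1} C_{ks} f`, `C_r f = ∫_0^1 f(x) cos 2πrx dx`), and with that reading the `K`-terms are
consistent: `Σ_s μ_s ζ(2q) K_{2q}/(ms)^{2q} = K_{2q}/m^{2q}` because `Σ_s μ_s s^{-2q} = 1/ζ(2q)`. We formalise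
the `E_{ms}` reading.

What is formalised (imports the Sect. 2.9 anchor `PeriodicTrapezoidalExactness` for the aliasing node sums
`Σ_{k<n} cos(2πjk/n) = n·[n ∣ j]`, `sum_range_cos_two_pi_mul_div`, which are USED, not re-proved):

* the objects: `mipsTrapezoid s f = T_s(f)`, `mipsZeta k = ζ(k)` (a real `tsum`), `mipsE K n s f = E_s(f)`
  (2.10.6.2), the endpoint-derivative choice `mipsK f q = K_{2q}` (2.10.6.4), cosine polynomials
  `mipsCosPoly a N = Σ_{r=0}^{N} a_r cos 2πrx` (the band-limited test class);
* PROVED — the mechanism of the method on cosine polynomials, where every series is a finite sum: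
  `T_s = periodicTrapezoidal 1 s` on integrands with `f(0) = f(1)` (`mipsTrapezoid_eq_periodicTrapezoidal`),
  ALIASING `T_s(cos 2πr·) = [s ∣ r]` (`mipsTrapezoid_cos`, from the imported node sums); the exact POISSON SUMMATION FORMULA
  `T_s f - I f = Σ_{1≤r≤N, s∣r} a_r` (`mipsTrapezoid_sub_integral_mipsCosPoly`), `I f = a_0` (`integral_mipsCosPoly`),
  the cosine coefficients `2 ∫_0^1 f(x) cos 2πmx dx = a_m` (`two_mul_integral_mipsCosPoly_mul_cos`), the MÖBIUS INVERSION (engine: `Σ_{d∣t} μ_d = [t = 1]`,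
  Mathlib's `μ * ζ = 1`)
  `Σ_{s=1}^{N} μ_s (T_{ms} f - I f) = a_m = 2 ∫_0^1 f cos 2πmx`, `1 ≤ m ≤ N` (`mips_inversion_mipsCosPoly`,
  `mips_identity_mipsCosPoly`) — identity (2.10.6.3) with `n = 0` for band-limited `f`, the series terminating at
  `s = N`;
* NAMED FACTS: `MIPSIdentity` ((2.10.6.3) as printed, for `f ∈ C[0,1]` and arbitrary `K`, the
  convergence of the series being part of the assertion; cited, not proved) and `MIPSTermDecay` (the
  `O(s^{-2n-2})` estimate under (2.10.6.4) for smooth `f`) — the latter PROVED in the appended section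
  (`MIPSTermDecay_holds`, from the Euler–Maclaurin expansion of Sect. 2.9, imported from
  `EulerMaclaurinTrapezoidal`).

Not formalised: Lyness's implementation, the modifications for piecewise continuous `f` and for peaks due to
nearby poles, the sine coefficients.
-/

open Finset MeasureTheory Real

namespace Literature.Analysis.Quadrature

/-! ## The objects -/

/-- The endpoint trapezoidal rule on `[0, 1]` with `s` panels,
`T_s(f) = (1/s)[½ f(0) + Σ_{j=1}^{s-1} f(j/s) + ½ f(1)]` (junk value `0`-weighted for `s = 0`).
[cite: DavisRabinowitz1984, Sect. 2.10.6 (display before (2.10.6.2))] -/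
noncomputable def mipsTrapezoid (s : ℕ) (f : ℝ → ℝ) : ℝ :=
  (1 / (s : ℝ)) * (f 0 / 2 + ∑ j ∈ Ico 1 s, f ((j : ℝ) / s) + f 1 / 2)

/-- `ζ(k) = Σ_{j≥1} j^{-k}` as a real number. [cite: DavisRabinowitz1984, Sect. 2.10.6 (display before (2.10.6.2))] -/
noncomputable def mipsZeta (k : ℕ) : ℝ := ∑' j : ℕ, 1 / ((j : ℝ) + 1) ^ k

/-- `E_s(f) = T_s(f) - I(f) - Σ_{q=1}^{n} ζ(2q) K_{2q}/s^{2q}` **(2.10.6.2)**; `K q` stands for `K_{2q}`.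
[cite: DavisRabinowitz1984, Sect. 2.10.6 (2.10.6.2)] -/
noncomputable def mipsE (K : ℕ → ℝ) (n s : ℕ) (f : ℝ → ℝ) : ℝ :=
  mipsTrapezoid s f - (∫ x in (0:ℝ)..1, f x) - ∑ q ∈ Icc 1 n, mipsZeta (2 * q) * K q / (s : ℝ) ^ (2 * q)

/-- The endpoint-derivative choice **(2.10.6.4)**: `K_{2q} = 2(-1)^{q-1}(f^{(2q-1)}(1) - f^{(2q-1)}(0))/(2π)^{2q}`.
[cite: DavisRabinowitz1984, Sect. 2.10.6 (2.10.6.4)] -/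
noncomputable def mipsK (f : ℝ → ℝ) (q : ℕ) : ℝ :=
  2 * (-1) ^ (q - 1) * (iteratedDeriv (2 * q - 1) f 1 - iteratedDeriv (2 * q - 1) f 0) / (2 * π) ^ (2 * q)

/-- A cosine polynomial `Σ_{r=0}^{N} a_r cos 2πrx` (band-limited test function).
[cite: DavisRabinowitz1984, Sect. 2.10.6] -/
noncomputable def mipsCosPoly (a : ℕ → ℝ) (N : ℕ) (x : ℝ) : ℝ :=
  ∑ r ∈ range (N + 1), a r * cos (2 * π * r * x)

/-- The MIPS identity **(2.10.6.3)** as printed (with the series read `Σ_s μ_s E_{ms}(f)`, see the reading note):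
for `f ∈ C[0,1]`, `n ≥ 0` and any `K_2, …, K_{2n}`, and every `m ≥ 1`, the series converges and
`2 ∫_0^1 f(x) cos 2πmx dx = Σ_{q=1}^{n} K_{2q}/m^{2q} + Σ_{s≥1} μ_s E_{ms}(f)`. A cited external result
(Goldberg–Varga, Lyness), NOT proved here; the band-limited case with `n = 0` is `mips_identity_mipsCosPoly`.
[cite: DavisRabinowitz1984, Sect. 2.10.6 (2.10.6.3)] -/
def MIPSIdentity (f : ℝ → ℝ) (n : ℕ) (K : ℕ → ℝ) : Prop :=
  ContinuousOn f (Set.Icc 0 1) → ∀ m : ℕ, 1 ≤ m →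
    HasSum (fun s : ℕ => (ArithmeticFunction.moebius (s + 1) : ℝ) * mipsE K n (m * (s + 1)) f)
      (2 * (∫ x in (0:ℝ)..1, f x * cos (2 * π * m * x)) - ∑ q ∈ Icc 1 n, K q / (m : ℝ) ^ (2 * q))

/-- The decay statement: for `f` smooth on `[0,1]` and the choice (2.10.6.4), the `s`-th term of the series in
(2.10.6.3) is `O(s^{-2n-2})`, uniformly providing accuracy in `m`. PROVED at the end of the file
(`MIPSTermDecay_holds`). [cite: DavisRabinowitz1984, Sect. 2.10.6 (2.10.6.3)-(2.10.6.4)] -/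
def MIPSTermDecay (f : ℝ → ℝ) (n : ℕ) : Prop :=
  ContDiff ℝ ⊤ f → ∀ m : ℕ, 1 ≤ m → ∃ C : ℝ, ∀ s : ℕ, 1 ≤ s →
    |(ArithmeticFunction.moebius s : ℝ) * mipsE (mipsK f) n (m * s) f| ≤ C / (s : ℝ) ^ (2 * n + 2)

/-! ## Möbius numbers -/

/-- `Σ_{d ∣ t} μ_d = [t = 1]` in `ℝ` — the inversion engine (Mathlib: `μ * ζ = 1`); a private copy of a
three-line Mathlib consequence that also appears (public) in `Literature/NumberTheory/Sieve/SieveFrameworkProofs.lean`,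
not imported here. [folklore] -/
private theorem mips_sum_divisors_moebius (t : ℕ) :
    ∑ d ∈ t.divisors, (ArithmeticFunction.moebius d : ℝ) = if t = 1 then 1 else 0 := by
  have h := congrArg (fun F : ArithmeticFunction ℝ => F t)
    (ArithmeticFunction.coe_moebius_mul_coe_zeta (R := ℝ))
  simp only [ArithmeticFunction.coe_mul_zeta_apply, ArithmeticFunction.intCoe_apply,
    ArithmeticFunction.one_apply] at h
  exact h

/-! ## Aliasing and the exact Poisson summation formula for cosine polynomials -/

/-- For an integrand with `f(0) = f(1)` the endpoint rule is the rectangle rule `(1/s) Σ_{j<s} f(j/s)`.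
[cite: DavisRabinowitz1984, Sect. 2.10.6 (display before (2.10.6.2))] -/
theorem mipsTrapezoid_eq_of_periodic {s : ℕ} (hs : s ≠ 0) {f : ℝ → ℝ} (hf : f 0 = f 1) :
    mipsTrapezoid s f = (1 / (s : ℝ)) * ∑ j ∈ range s, f ((j : ℝ) / s) := by
  unfold mipsTrapezoid
  congr 1
  rw [Finset.range_eq_Ico, Finset.sum_eq_sum_Ico_succ_bot (Nat.pos_of_ne_zero hs)]
  simp only [Nat.cast_zero, zero_div, zero_add]
  rw [hf]
  ring

/-- … i.e. it is the periodic trapezoidal rule `periodicTrapezoidal 1 s f` of the Sect. 2.9 anchor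
(`PeriodicTrapezoidalExactness.lean`, (2.9.19)). [cite: DavisRabinowitz1984, Sect. 2.10.6; Sect. 2.9 (2.9.19)] -/
theorem mipsTrapezoid_eq_periodicTrapezoidal {s : ℕ} (hs : s ≠ 0) {f : ℝ → ℝ} (hf : f 0 = f 1) :
    mipsTrapezoid s f = periodicTrapezoidal 1 s f := by
  rw [mipsTrapezoid_eq_of_periodic hs hf]
  simp only [periodicTrapezoidal, mul_one]

/-- ALIASING: `T_s(cos 2πr·) = 1` if `s ∣ r` and `0` otherwise (`s ≥ 1`).
[cite: DavisRabinowitz1984, Sect. 2.10.6] -/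
theorem mipsTrapezoid_cos {s : ℕ} (hs : s ≠ 0) (r : ℕ) :
    mipsTrapezoid s (fun x => cos (2 * π * r * x)) = if s ∣ r then 1 else 0 := by
  have hper : (fun x : ℝ => cos (2 * π * r * x)) 0 = (fun x : ℝ => cos (2 * π * r * x)) 1 := by
    simp only [mul_zero, cos_zero, mul_one]
    rw [show (2 : ℝ) * π * r = (r : ℕ) * (2 * π) by ring, Real.cos_nat_mul_two_pi]
  rw [mipsTrapezoid_eq_of_periodic hs hper]
  have hsum := sum_range_cos_two_pi_mul_div hs (r : ℤ)
  have hcongr : ∑ j ∈ range s, cos (2 * π * r * ((j : ℝ) / s)) = ∑ k ∈ range s, cos (2 * π * (r : ℤ) * k / s) := by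
    refine Finset.sum_congr rfl fun k _ => ?_
    push_cast
    ring_nf
  rw [hcongr, hsum]
  have hsR : (s : ℝ) ≠ 0 := by exact_mod_cast hs
  by_cases h : s ∣ r
  · rw [if_pos (Int.natCast_dvd_natCast.mpr h), if_pos h]
    field_simp
  · rw [if_neg (fun h' => h (Int.natCast_dvd_natCast.mp h')), if_neg h, mul_zero]

/-- Linearity of `T_s` over finite sums. [cite: DavisRabinowitz1984, Sect. 2.10.6] -/
theorem mipsTrapezoid_finset_sum {ι : Type*} (s : ℕ) (R : Finset ι) (g : ι → ℝ → ℝ) :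
    mipsTrapezoid s (fun x => ∑ r ∈ R, g r x) = ∑ r ∈ R, mipsTrapezoid s (g r) := by
  unfold mipsTrapezoid
  rw [Finset.sum_comm, Finset.sum_div, Finset.sum_div, ← Finset.sum_add_distrib, ← Finset.sum_add_distrib,
    Finset.mul_sum]

/-- Homogeneity of `T_s`. [cite: DavisRabinowitz1984, Sect. 2.10.6] -/
theorem mipsTrapezoid_const_mul (s : ℕ) (c : ℝ) (f : ℝ → ℝ) :
    mipsTrapezoid s (fun x => c * f x) = c * mipsTrapezoid s f := by
  simp only [mipsTrapezoid]
  rw [← Finset.mul_sum]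
  ring

/-- `T_s` of a cosine polynomial: only the frequencies divisible by `s` survive.
[cite: DavisRabinowitz1984, Sect. 2.10.6] -/
theorem mipsTrapezoid_mipsCosPoly {s : ℕ} (hs : s ≠ 0) (a : ℕ → ℝ) (N : ℕ) :
    mipsTrapezoid s (mipsCosPoly a N) = ∑ r ∈ range (N + 1), if s ∣ r then a r else 0 := by
  have h : mipsCosPoly a N = fun x => ∑ r ∈ range (N + 1), a r * cos (2 * π * r * x) := rfl
  rw [h, mipsTrapezoid_finset_sum]
  refine Finset.sum_congr rfl fun r _ => ?_
  rw [mipsTrapezoid_const_mul, mipsTrapezoid_cos hs, mul_ite, mul_one, mul_zero]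

/-- `∫_0^1 cos 2πkx dx = [k = 0]` for an integer frequency `k`. [cite: DavisRabinowitz1984, Sect. 2.10.6] -/
theorem integral_cos_two_pi_int_mul (k : ℤ) :
    ∫ x in (0:ℝ)..1, cos (2 * π * k * x) = if k = 0 then 1 else 0 := by
  split_ifs with hk
  · subst hk
    simp
  · have hc : (2 * π * k : ℝ) ≠ 0 := by
      have : (k : ℝ) ≠ 0 := by exact_mod_cast hk
      positivity
    rw [intervalIntegral.integral_comp_mul_left (fun x => cos x) hc, integral_cos]
    simp only [mul_zero, mul_one, sin_zero, sub_zero, smul_eq_mul]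
    rw [show (2 : ℝ) * π * k = ((2 * k : ℤ) : ℝ) * π by push_cast; ring, Real.sin_int_mul_pi, mul_zero]

/-- Same with a natural frequency. [cite: DavisRabinowitz1984, Sect. 2.10.6] -/
theorem integral_cos_two_pi_nat_mul (r : ℕ) :
    ∫ x in (0:ℝ)..1, cos (2 * π * r * x) = if r = 0 then 1 else 0 := by
  have h := integral_cos_two_pi_int_mul (r : ℤ)
  push_cast at h
  rw [h]
  simp only [Nat.cast_eq_zero]

/-- `I(f) = a_0` for a cosine polynomial. [cite: DavisRabinowitz1984, Sect. 2.10.6] -/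
theorem integral_mipsCosPoly (a : ℕ → ℝ) (N : ℕ) : ∫ x in (0:ℝ)..1, mipsCosPoly a N x = a 0 := by
  unfold mipsCosPoly
  rw [intervalIntegral.integral_finsetSum]
  · have : ∀ r ∈ range (N + 1), ∫ x in (0:ℝ)..1, a r * cos (2 * π * r * x) = if r = 0 then a r else 0 := by
      intro r _
      rw [intervalIntegral.integral_const_mul, integral_cos_two_pi_nat_mul, mul_ite, mul_one, mul_zero]
    rw [Finset.sum_congr rfl this, Finset.sum_ite_eq']
    simp
  · intro r _
    exact (Continuous.intervalIntegrable (by fun_prop) _ _)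

/-- The exact POISSON SUMMATION FORMULA for a cosine polynomial: `T_s f - I f = Σ_{1 ≤ r ≤ N, s ∣ r} a_r`
(`= 2 Σ_{k≥1} C_{ks} f`, all but finitely many terms vanishing). [cite: DavisRabinowitz1984, Sect. 2.10.6] -/
theorem mipsTrapezoid_sub_integral_mipsCosPoly {s : ℕ} (hs : s ≠ 0) (a : ℕ → ℝ) (N : ℕ) :
    mipsTrapezoid s (mipsCosPoly a N) - ∫ x in (0:ℝ)..1, mipsCosPoly a N x =
      ∑ r ∈ Icc 1 N, if s ∣ r then a r else 0 := by
  rw [mipsTrapezoid_mipsCosPoly hs, integral_mipsCosPoly, Finset.range_eq_Ico,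
    Finset.sum_eq_sum_Ico_succ_bot (show 0 < N + 1 by omega), zero_add, Finset.Ico_add_one_right_eq_Icc,
    if_pos (dvd_zero s)]
  ring

/-- The cosine coefficients of a cosine polynomial: `2 ∫_0^1 f(x) cos 2πmx dx = a_m` for `1 ≤ m ≤ N`.
[cite: DavisRabinowitz1984, Sect. 2.10.6 (2.10.6.3)] -/
theorem two_mul_integral_mipsCosPoly_mul_cos (a : ℕ → ℝ) {N m : ℕ} (hm : 1 ≤ m) (hmN : m ≤ N) :
    2 * ∫ x in (0:ℝ)..1, mipsCosPoly a N x * cos (2 * π * m * x) = a m := by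
  have hprod : ∀ x : ℝ, mipsCosPoly a N x * cos (2 * π * m * x) =
      ∑ r ∈ range (N + 1), a r / 2 *
        (cos (2 * π * (((r : ℤ) - (m : ℤ) : ℤ) : ℝ) * x) + cos (2 * π * (((r : ℤ) + (m : ℤ) : ℤ) : ℝ) * x)) := by
    intro x
    unfold mipsCosPoly
    rw [Finset.sum_mul]
    refine Finset.sum_congr rfl fun r _ => ?_
    have : cos (2 * π * r * x) * cos (2 * π * m * x) =
        (cos (2 * π * (((r : ℤ) - (m : ℤ) : ℤ) : ℝ) * x) + cos (2 * π * (((r : ℤ) + (m : ℤ) : ℤ) : ℝ) * x)) / 2 := by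
      push_cast
      rw [show 2 * π * ((r : ℝ) - m) * x = 2 * π * r * x - 2 * π * m * x by ring,
        show 2 * π * ((r : ℝ) + m) * x = 2 * π * r * x + 2 * π * m * x by ring, cos_sub, cos_add]
      ring
    rw [mul_assoc, this]
    ring
  simp_rw [hprod]
  rw [intervalIntegral.integral_finsetSum]
  · have hterm : ∀ r ∈ range (N + 1),
        ∫ x in (0:ℝ)..1, a r / 2 *
            (cos (2 * π * (((r : ℤ) - (m : ℤ) : ℤ) : ℝ) * x) + cos (2 * π * (((r : ℤ) + (m : ℤ) : ℤ) : ℝ) * x)) =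
          if r = m then a r / 2 else 0 := by
      intro r _
      rw [intervalIntegral.integral_const_mul,
        intervalIntegral.integral_add (Continuous.intervalIntegrable (by fun_prop) _ _)
          (Continuous.intervalIntegrable (by fun_prop) _ _),
        integral_cos_two_pi_int_mul ((r : ℤ) - (m : ℤ)), integral_cos_two_pi_int_mul ((r : ℤ) + (m : ℤ))]
      have hne : ((r : ℤ) + m ≠ 0) := by omega
      have hiff : ((r : ℤ) - m = 0) ↔ r = m := by omega
      rw [if_neg hne]
      simp only [hiff]
      split_ifs <;> ring
    rw [Finset.sum_congr rfl hterm, Finset.sum_ite_eq']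
    have : m ∈ range (N + 1) := Finset.mem_range.mpr (by omega)
    rw [if_pos this]
    ring
  · intro r _
    exact Continuous.intervalIntegrable (by fun_prop) _ _

/-! ## Möbius inversion -/

/-- MÖBIUS INVERSION of the Poisson summation formula for a cosine polynomial: for `1 ≤ m ≤ N`,
`Σ_{s=1}^{N} μ_s (T_{ms} f - I f) = a_m` (all terms with `s > N` vanish, so this is the full series
`Σ_{s≥1} μ_s E_{ms}(f)` of (2.10.6.3) with `n = 0`). [cite: DavisRabinowitz1984, Sect. 2.10.6 (2.10.6.3)] -/
theorem mips_inversion_mipsCosPoly (a : ℕ → ℝ) {N m : ℕ} (hm : 1 ≤ m) (hmN : m ≤ N) :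
    ∑ s ∈ Icc 1 N, (ArithmeticFunction.moebius s : ℝ) *
        (mipsTrapezoid (m * s) (mipsCosPoly a N) - ∫ x in (0:ℝ)..1, mipsCosPoly a N x) = a m := by
  have hE : ∀ s ∈ Icc 1 N, mipsTrapezoid (m * s) (mipsCosPoly a N) - ∫ x in (0:ℝ)..1, mipsCosPoly a N x =
      ∑ r ∈ Icc 1 N, if m * s ∣ r then a r else 0 := by
    intro s hs
    have hs1 : 1 ≤ s := (Finset.mem_Icc.mp hs).1
    exact mipsTrapezoid_sub_integral_mipsCosPoly (Nat.mul_ne_zero (by omega) (by omega)) a N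
  rw [Finset.sum_congr rfl fun s hs => by rw [hE s hs]]
  simp_rw [Finset.mul_sum]
  rw [Finset.sum_comm]
  have key : ∀ r ∈ Icc 1 N,
      ∑ s ∈ Icc 1 N, (ArithmeticFunction.moebius s : ℝ) * (if m * s ∣ r then a r else 0) =
        if m = r then a r else 0 := by
    intro r hr
    have hr1 : 1 ≤ r := (Finset.mem_Icc.mp hr).1
    have hrN : r ≤ N := (Finset.mem_Icc.mp hr).2
    by_cases hmr : m ∣ r
    · obtain ⟨t, rfl⟩ := hmr
      have ht1 : 1 ≤ t := by
        rcases Nat.eq_zero_or_pos t with h | h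
        · subst h; simp at hr1
        · exact h
      have htN : t ≤ N := by nlinarith
      have hdvd : ∀ s, (m * s ∣ m * t ↔ s ∣ t) := fun s => Nat.mul_dvd_mul_iff_left (by omega)
      simp_rw [hdvd]
      rw [← Finset.sum_filter_add_sum_filter_not (Icc 1 N) (fun s => s ∣ t)]
      have hzero : ∑ s ∈ (Icc 1 N).filter (fun s => ¬ s ∣ t),
          (ArithmeticFunction.moebius s : ℝ) * (if s ∣ t then a (m * t) else 0) = 0 := by
        refine Finset.sum_eq_zero fun s hs => ?_
        rw [if_neg (Finset.mem_filter.mp hs).2, mul_zero]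
      have hfilt : (Icc 1 N).filter (fun s => s ∣ t) = t.divisors := by
        ext s
        simp only [Finset.mem_filter, Finset.mem_Icc, Nat.mem_divisors]
        constructor
        · rintro ⟨⟨h1, _⟩, hd⟩
          exact ⟨hd, by omega⟩
        · rintro ⟨hd, _⟩
          exact ⟨⟨Nat.pos_of_dvd_of_pos hd (by omega), (Nat.le_of_dvd (by omega) hd).trans htN⟩, hd⟩
      have hmain : ∑ s ∈ (Icc 1 N).filter (fun s => s ∣ t),
          (ArithmeticFunction.moebius s : ℝ) * (if s ∣ t then a (m * t) else 0) =
            a (m * t) * ∑ d ∈ t.divisors, (ArithmeticFunction.moebius d : ℝ) := by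
        rw [hfilt, Finset.mul_sum]
        refine Finset.sum_congr rfl fun s hs => ?_
        rw [if_pos (Nat.mem_divisors.mp hs).1]
        ring
      rw [hzero, add_zero, hmain, mips_sum_divisors_moebius]
      have hiff : (m = m * t) ↔ t = 1 := by
        constructor
        · intro h
          exact (Nat.eq_of_mul_eq_mul_left (by omega) (h.symm.trans (mul_one m).symm))
        · intro h
          rw [h, mul_one]
      by_cases ht : t = 1
      · rw [if_pos ht, if_pos (hiff.mpr ht), mul_one]
      · rw [if_neg ht, if_neg (fun h => ht (hiff.mp h)), mul_zero]
    · have hnone : ∀ s, ¬ (m * s ∣ r) := fun s h => hmr (Dvd.dvd.trans (Dvd.intro s rfl) h)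
      simp_rw [if_neg (hnone _), mul_zero, Finset.sum_const_zero]
      rw [if_neg]
      rintro rfl
      exact hmr dvd_rfl
  rw [Finset.sum_congr rfl key, Finset.sum_ite_eq]
  rw [if_pos (Finset.mem_Icc.mpr ⟨hm, hmN⟩)]

/-- Identity **(2.10.6.3)** with `n = 0` for a band-limited `f`: `2 ∫_0^1 f cos 2πmx = Σ_{s=1}^{N} μ_s (T_{ms} f - I f)`.
[cite: DavisRabinowitz1984, Sect. 2.10.6 (2.10.6.3)] -/
theorem mips_identity_mipsCosPoly (a : ℕ → ℝ) {N m : ℕ} (hm : 1 ≤ m) (hmN : m ≤ N) :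
    2 * ∫ x in (0:ℝ)..1, mipsCosPoly a N x * cos (2 * π * m * x) =
      ∑ s ∈ Icc 1 N, (ArithmeticFunction.moebius s : ℝ) *
        (mipsTrapezoid (m * s) (mipsCosPoly a N) - ∫ x in (0:ℝ)..1, mipsCosPoly a N x) := by
  rw [two_mul_integral_mipsCosPoly_mul_cos a hm hmN, mips_inversion_mipsCosPoly a hm hmN]

/-- … equivalently, in terms of `E_s` (2.10.6.2) with no correction terms (`n = 0`): `mipsE K 0 s f = T_s f - I f`.
[cite: DavisRabinowitz1984, Sect. 2.10.6 (2.10.6.2)] -/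
theorem mipsE_zero (K : ℕ → ℝ) (s : ℕ) (f : ℝ → ℝ) :
    mipsE K 0 s f = mipsTrapezoid s f - ∫ x in (0:ℝ)..1, f x := by
  simp [mipsE]

/-! ## Proof of the decay of the MIPS terms (`MIPSTermDecay_holds`)

With Euler's formula `ζ(2q) = (-1)^{q+1} 2^{2q-1} π^{2q} B_{2q}/(2q)!` (Mathlib's `hasSum_zeta_nat`) the
corrections `ζ(2q) K_{2q}/N^{2q}` of (2.10.6.2) under the choice (2.10.6.4) are exactly the Bernoulli terms
`(B_{2q}/(2q)!) N^{-2q} [f^{(2q-1)}(1) - f^{(2q-1)}(0)]` of the Euler–Maclaurin expansion of the trapezoidal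
rule (Sect. 2.9, the tree's `trapezoidal_integral_eq_eulerMaclaurin`, imported), so for smooth `f` the error
functional `E_N(f)` is the next Bernoulli term plus the `P_{2n+3}`-remainder, both `O(N^{-2n-2})`; with
`|μ_s| ≤ 1` and `N = ms ≥ s` this is the printed `O(s^{-2n-2})`.
-/

open Set
open scoped ContDiff

section MIPSTermDecayProof

open Literature.NumberTheory.LFunctions

/-- `T_s` of this file is Mathlib's `trapezoidal_integral` on `[0, 1]` (`s ≥ 1`). [folklore] -/
private theorem mipsTrapezoid_eq_trapezoidal_integral (s : ℕ) (f : ℝ → ℝ) :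
    mipsTrapezoid s f = trapezoidal_integral f s 0 1 := by
  unfold mipsTrapezoid trapezoidal_integral
  rw [Finset.sum_Ico_eq_sum_range]
  have hsum : ∑ k ∈ Finset.range (s - 1), f (((1 + k : ℕ) : ℝ) / s) =
      ∑ k ∈ Finset.range (s - 1), f (0 + ((k : ℝ) + 1) * (1 - 0) / s) := by
    refine Finset.sum_congr rfl fun k _ => ?_
    congr 1
    push_cast
    ring
  rw [hsum]
  ring

/-- `ζ(2q) = Σ_{j≥1} j^{-2q}` in the indexing of `mipsZeta` and Euler's formula:
`mipsZeta (2q) = (-1)^{q+1} 2^{2q-1} π^{2q} B_{2q}/(2q)!` (`q ≥ 1`). [folklore] -/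
private theorem mipsZeta_two_mul {q : ℕ} (hq : q ≠ 0) :
    mipsZeta (2 * q) = (-1 : ℝ) ^ (q + 1) * (2 : ℝ) ^ (2 * q - 1) * Real.pi ^ (2 * q) *
      bernoulli (2 * q) / (2 * q).factorial := by
  have h := hasSum_zeta_nat hq
  have h1 := (hasSum_nat_add_iff (f := fun n : ℕ => 1 / (n : ℝ) ^ (2 * q)) 1).mpr
    (by simpa [Finset.sum_range_one, zero_pow (by omega : 2 * q ≠ 0)] using h)
  unfold mipsZeta
  rw [← h1.tsum_eq]
  refine tsum_congr fun j => ?_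
  push_cast
  ring_nf

/-- The correction terms of `E_s` with the choice (2.10.6.4) are the Euler–Maclaurin Bernoulli terms:
`ζ(2q) K_{2q}/N^{2q} = (B_{2q}/(2q)!) (1/N)^{2q} (f^{(2q-1)}(1) - f^{(2q-1)}(0))`. [folklore] -/
private theorem mipsZeta_mul_mipsK {q : ℕ} (hq : q ≠ 0) (f : ℝ → ℝ) {N : ℝ} (hN : N ≠ 0) :
    mipsZeta (2 * q) * mipsK f q / N ^ (2 * q) =
      (bernoulli (2 * q) : ℝ) / (2 * q).factorial * ((1 - 0) / N) ^ (2 * q) *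
        (iteratedDeriv (2 * q - 1) f 1 - iteratedDeriv (2 * q - 1) f 0) := by
  rw [mipsZeta_two_mul hq, mipsK]
  set Δ : ℝ := iteratedDeriv (2 * q - 1) f 1 - iteratedDeriv (2 * q - 1) f 0
  set B : ℝ := (bernoulli (2 * q) : ℝ)
  have hsgn : ((-1 : ℝ) ^ (q + 1)) * (-1) ^ (q - 1) = 1 := by
    rw [← pow_add, show q + 1 + (q - 1) = 2 * q by omega, pow_mul]
    norm_num
  have h2pow : (2 : ℝ) ^ (2 * q - 1) * 2 = (2 : ℝ) ^ (2 * q) := by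
    rw [← pow_succ]
    congr 1
    omega
  have hfac : ((2 * q).factorial : ℝ) ≠ 0 := by positivity
  have h2 : (2 : ℝ) ^ (2 * q) ≠ 0 := by positivity
  have hpi : (Real.pi : ℝ) ^ (2 * q) ≠ 0 := by positivity
  have hNq : N ^ (2 * q) ≠ 0 := pow_ne_zero _ hN
  calc (-1 : ℝ) ^ (q + 1) * 2 ^ (2 * q - 1) * Real.pi ^ (2 * q) * B / (2 * q).factorial *
        (2 * (-1) ^ (q - 1) * Δ / (2 * Real.pi) ^ (2 * q)) / N ^ (2 * q)
      = ((-1 : ℝ) ^ (q + 1) * (-1) ^ (q - 1)) * (2 ^ (2 * q - 1) * 2) * Real.pi ^ (2 * q) * B * Δ /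
          ((2 * q).factorial * (2 * Real.pi) ^ (2 * q) * N ^ (2 * q)) := by
        rw [mul_pow]
        field_simp
    _ = B / (2 * q).factorial * ((1 - 0) / N) ^ (2 * q) * Δ := by
        rw [hsgn, h2pow, one_mul, mul_pow, sub_zero, div_pow, one_pow]
        field_simp

/-- **The decay of the MIPS terms, PROVED**: for `f` smooth (`ContDiff ℝ ⊤ f`), `m ≥ 1` and the choice
(2.10.6.4) of `K_{2q}`, `|μ_s E_{ms}(f)| ≤ C/s^{2n+2}` for all `s ≥ 1`. With Euler's formula for `ζ(2q)`
the corrections `Σ_{q ≤ n} ζ(2q) K_{2q}/N^{2q}` are exactly the Bernoulli terms of the Euler–Maclaurin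
expansion of `T_N` (tree: `trapezoidal_integral_eq_eulerMaclaurin`, Sect. 2.9), so `E_N(f)` is the next
Bernoulli term plus the `P_{2n+3}` remainder, both `O(N^{-2n-2})`; and `|μ_s| ≤ 1`, `N = ms ≥ s`.
Discharge of the named fact `MIPSTermDecay`. [cite: DavisRabinowitz1984, Sect. 2.10.6 (2.10.6.2)-(2.10.6.4)] -/
theorem MIPSTermDecay_holds : ∀ (f : ℝ → ℝ) (n : ℕ), MIPSTermDecay f n := by
  intro f n hf m hm
  have hf' : ContDiff ℝ ∞ f := hf.of_le le_top
  -- the derivative family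
  set g : ℕ → ℝ → ℝ := fun j => iteratedDeriv j f with hg
  have hgd : ∀ (j : ℕ) (x : ℝ), HasDerivAt (g j) (g (j + 1) x) x := by
    intro j x
    simp only [hg]
    rw [iteratedDeriv_succ]
    exact ((hf'.differentiable_iteratedDeriv j (mod_cast ENat.coe_lt_top j)) x).hasDerivAt
  have hgc : ∀ j : ℕ, Continuous (g j) := fun j => hf'.continuous_iteratedDeriv j (mod_cast le_top)
  -- constants
  obtain ⟨β, hβ0, hβ⟩ := exists_bound_bernoulliPer (2 * (n + 1) + 1)
  obtain ⟨M, hM⟩ := isCompact_Icc.exists_bound_of_continuousOn ((hgc (2 * (n + 1) + 1)).continuousOn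
    (s := Icc (0 : ℝ) 1))
  have hM0 : 0 ≤ M := (norm_nonneg _).trans (hM 0 (by simp))
  set Δ : ℝ := iteratedDeriv (2 * (n + 1) - 1) f 1 - iteratedDeriv (2 * (n + 1) - 1) f 0 with hΔ
  set C : ℝ := |(bernoulli (2 * (n + 1)) : ℝ)| / (2 * (n + 1)).factorial * |Δ| +
    β * M / (2 * (n + 1) + 1).factorial with hC
  have hC0 : 0 ≤ C := by positivity
  refine ⟨C, fun s hs => ?_⟩
  -- `N = m s` panels
  have hN : 0 < m * s := Nat.mul_pos (by omega) (by omega)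
  have hNr : (1 : ℝ) ≤ (m * s : ℕ) := by exact_mod_cast hN
  have hN0 : (0 : ℝ) < (m * s : ℕ) := by linarith
  -- Euler–Maclaurin with `k = n + 1`
  have hem := trapezoidal_integral_eq_eulerMaclaurin (g := g) (a := 0) (b := 1) zero_le_one (k := n + 1)
    (fun j _ x _ => hgd j x) ((hgc _).continuousOn) hN
  have hg0 : g 0 = f := by simp [hg]
  rw [hg0] at hem
  -- the error functional
  have hE : mipsE (mipsK f) n (m * s) f =
      (bernoulli (2 * (n + 1)) : ℝ) / (2 * (n + 1)).factorial * ((1 - 0) / (m * s : ℕ)) ^ (2 * (n + 1)) * Δ +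
      ((1 - 0) / (m * s : ℕ)) ^ (2 * (n + 1) + 1) / (2 * (n + 1) + 1).factorial *
        ∫ x in (0 : ℝ)..1, bernoulliPer (2 * (n + 1) + 1) ((m * s : ℕ) * (x - 0) / (1 - 0)) *
          g (2 * (n + 1) + 1) x := by
    unfold mipsE
    rw [mipsTrapezoid_eq_trapezoidal_integral (m * s) f, hem, Finset.sum_Icc_succ_top (by omega : 1 ≤ n + 1)]
    have hcorr : ∑ q ∈ Finset.Icc 1 n, mipsZeta (2 * q) * mipsK f q / ((m * s : ℕ) : ℝ) ^ (2 * q) =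
        ∑ j ∈ Finset.Icc 1 n, (bernoulli (2 * j) : ℝ) / (2 * j).factorial *
          ((1 - 0) / ((m * s : ℕ) : ℝ)) ^ (2 * j) * (g (2 * j - 1) 1 - g (2 * j - 1) 0) := by
      refine Finset.sum_congr rfl fun q hq => ?_
      rw [Finset.mem_Icc] at hq
      rw [mipsZeta_mul_mipsK (by omega) f hN0.ne']
    rw [hcorr]
    simp only [hg, hΔ]
    ring
  -- bounds
  have hint : |∫ x in (0 : ℝ)..1, bernoulliPer (2 * (n + 1) + 1) ((m * s : ℕ) * (x - 0) / (1 - 0)) *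
      g (2 * (n + 1) + 1) x| ≤ β * M := by
    have h := intervalIntegral.norm_integral_le_of_norm_le_const (a := (0 : ℝ)) (b := 1) (C := β * M)
      (f := fun x => bernoulliPer (2 * (n + 1) + 1) ((m * s : ℕ) * (x - 0) / (1 - 0)) * g (2 * (n + 1) + 1) x)
      (fun x hx => by
        rw [norm_mul, Real.norm_eq_abs]
        have hx' : x ∈ Icc (0 : ℝ) 1 := by
          rw [uIoc_of_le zero_le_one] at hx
          exact ⟨hx.1.le, hx.2⟩
        exact mul_le_mul (hβ _) (hM x hx') (norm_nonneg _) hβ0.le)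
    simpa using h
  have hpow1 : ((1 - 0) / ((m * s : ℕ) : ℝ)) ^ (2 * (n + 1)) = 1 / ((m * s : ℕ) : ℝ) ^ (2 * n + 2) := by
    rw [sub_zero, div_pow, one_pow, show 2 * (n + 1) = 2 * n + 2 by ring]
  have hpow2 : ((1 - 0) / ((m * s : ℕ) : ℝ)) ^ (2 * (n + 1) + 1) ≤ 1 / ((m * s : ℕ) : ℝ) ^ (2 * n + 2) := by
    rw [sub_zero, div_pow, one_pow, show 2 * (n + 1) + 1 = (2 * n + 2) + 1 by ring, pow_succ]
    rw [div_le_div_iff_of_pos_left one_pos (by positivity) (by positivity)]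
    exact le_mul_of_one_le_right (by positivity) hNr
  have hNs : 1 / ((m * s : ℕ) : ℝ) ^ (2 * n + 2) ≤ 1 / (s : ℝ) ^ (2 * n + 2) := by
    have hs0 : (0 : ℝ) < s := by exact_mod_cast hs
    have hms : (s : ℝ) ≤ ((m * s : ℕ) : ℝ) := by
      have : (1 : ℝ) ≤ m := by exact_mod_cast hm
      push_cast
      nlinarith
    exact one_div_le_one_div_of_le (by positivity) (pow_le_pow_left₀ hs0.le hms _)
  -- `|μ_s| ≤ 1`
  have hμ : |(ArithmeticFunction.moebius s : ℝ)| ≤ 1 := by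
    have h := ArithmeticFunction.abs_moebius_le_one (n := s)
    rw [← Int.cast_abs]
    exact_mod_cast h
  rw [abs_mul]
  calc |(ArithmeticFunction.moebius s : ℝ)| * |mipsE (mipsK f) n (m * s) f|
      ≤ 1 * |mipsE (mipsK f) n (m * s) f| := mul_le_mul_of_nonneg_right hμ (abs_nonneg _)
    _ = |mipsE (mipsK f) n (m * s) f| := one_mul _
    _ ≤ |(bernoulli (2 * (n + 1)) : ℝ)| / (2 * (n + 1)).factorial * (1 / ((m * s : ℕ) : ℝ) ^ (2 * n + 2)) * |Δ| +
          (1 / ((m * s : ℕ) : ℝ) ^ (2 * n + 2)) / (2 * (n + 1) + 1).factorial * (β * M) := by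
        rw [hE]
        refine (abs_add_le _ _).trans (add_le_add ?_ ?_)
        · rw [abs_mul, abs_mul, abs_div, hpow1, abs_of_pos (by positivity : (0 : ℝ) < 1 / _ ^ (2 * n + 2)),
            Nat.abs_cast]
        · rw [abs_mul, abs_div, Nat.abs_cast, abs_of_pos (by positivity :
            (0 : ℝ) < ((1 - 0) / ((m * s : ℕ) : ℝ)) ^ (2 * (n + 1) + 1))]
          exact mul_le_mul (div_le_div_of_nonneg_right hpow2 (by positivity)) hint (abs_nonneg _)
            (by positivity)
    _ = C * (1 / ((m * s : ℕ) : ℝ) ^ (2 * n + 2)) := by rw [hC]; ring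
    _ ≤ C * (1 / (s : ℝ) ^ (2 * n + 2)) := mul_le_mul_of_nonneg_left hNs hC0
    _ = C / (s : ℝ) ^ (2 * n + 2) := by ring

end MIPSTermDecayProof

end Literature.Analysis.Quadrature
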